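import Mathlib
import HarnessLib
import Summits.NavierStokesRegularity.NavierStokesRegularity.Theorems.TaylorModelRungThreeCertificateFormatVInterp

/-!
# Crux K1b-DR (stmt-NavierStokesRegularity-23954), line `taylor-model` — v3 certificate interpretation: BRIDGE LEMMAS between
# the semantic window objects of `TaylorModelV` (`Ker`, `kapp`, `KerMem`, `AbsLeW`, `InBox`) and the checker's coordinate objects
# (`linF`, `MemMat`, `AbsLeVec`, boxes), and the NAMED inverse `invMat` under the node test (successor engine-1 g67)

* `CertTables.matOfKer` / `kerOfMat`: window kernels ↔ coordinate matrices; `kapp_eq_linF` (the action of a kernel through the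
  semantic enumeration IS `linF` of its coordinate matrix, by `sum_nW_eq_sum_range`); `memMat_matOfKer` (`KerMem A (kerLo M)
  (kerHi M) → MemMat (matOfKer A) M`) and `kerMem_kerOfMat` (converse); `absLeVec_of_absLeW` / `absLeW_vecF_of_absLeVec`;
  `inBox_vecF_iff` (membership in a `vecF`-box in coordinates);
* `invMat_spec_of_nodeOK`: under `nodeOK`, `invMat n N.B` is the two-sided inverse of `dre N.B` on the `n × n` block (range
  sums both orders) and lies in `N.Ci` — the NAMED form of `exists_inv_of_nodeOK` (uniqueness of the two-sided inverse of
  the `Fin n` matrix), which `toCertDataV.Ci` uses;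
* consequences for the interpreted frames: `Ci_Cm_id` / `Cm_Ci_id` on window-supported states (the a14 exact-frame clause).

MODEL-lattice bookkeeping only (rung TL-M3); nothing here is a statement about the Navier–Stokes equations.
-/

-- the sub-problem namespace repeats the summit name by design (D-0017)
set_option linter.dupNamespace false

namespace Summit.NavierStokesRegularity.NavierStokesRegularity.Theorems.TaylorModelCert

open scoped BigOperators
open Literature.Analysis.FluidPDE.TaoCascade Literature.Analysis.FluidPDE.TaoCascade.TaylorChain
open Summit.NavierStokesRegularity.NavierStokesRegularity.Theorems.TaylorModelReadout
open Summit.NavierStokesRegularity.NavierStokesRegularity.Theorems.TaylorModelV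

namespace CertTables

variable {K : Type} (T : CertTables K)

/-! ### Kernels versus coordinate matrices -/

/-- The coordinate matrix of a window kernel. [folklore] -/
noncomputable def matOfKer (A : Ker) : ℕ → ℕ → ℝ := fun r c => A (T.wi r) (T.wk r) (T.wi c) (T.wk c)

/-- The window kernel of a coordinate matrix. [folklore] -/
noncomputable def kerOfMat (a : ℕ → ℕ → ℝ) : Ker := fun i' k' i k => a (T.idx i' k') (T.idx i k)

/-- `matOfKer (kerOfMat a)` agrees with `a` on the `n × n` block. [folklore] -/
theorem matOfKer_kerOfMat (a : ℕ → ℕ → ℝ) {r c : ℕ} (hr : r < T.n) (hc : c < T.n) :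
    T.matOfKer (T.kerOfMat a) r c = a r c := by
  simp only [matOfKer, kerOfMat, T.idx_wi_wk hr, T.idx_wi_wk hc]

/-- `kerOfMat (matOfKer A)` agrees with `A` on window index pairs. [folklore] -/
theorem kerOfMat_matOfKer (A : Ker) (i' : Fin 4) {k' : ℤ} (hk' : -T.Kb ≤ k' ∧ k' ≤ T.Ka) (i : Fin 4) {k : ℤ}
    (hk : -T.Kb ≤ k ∧ k ≤ T.Ka) : T.kerOfMat (T.matOfKer A) i' k' i k = A i' k' i k := by
  simp only [matOfKer, kerOfMat, T.wi_idx i' hk', T.wk_idx i' hk', T.wi_idx i hk, T.wk_idx i hk]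

/-- **The kernel action is `linF` of the coordinate matrix** (for a record with the tables' window). [folklore] -/
theorem kapp_eq_linF {cd : CertData} (hKb : cd.Kb = T.Kb) (hKa : cd.Ka = T.Ka) (A : Ker) (v : Fin 4 → ℤ → ℝ) :
    kapp cd A v = T.linF (T.matOfKer A) v := by
  funext i' k'
  by_cases hk' : -T.Kb ≤ k' ∧ k' ≤ T.Ka
  · have hk'' : -cd.Kb ≤ k' ∧ k' ≤ cd.Ka := by rw [hKb, hKa]; exact hk'
    unfold kapp
    rw [if_pos hk'', T.linF_apply_of_InW _ v i' hk']
    have h := T.sum_nW_eq_sum_range cd hKb hKa (fun i k => A i' k' i k * v i k)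
    simp only [toVec] at h ⊢
    rw [h]
    refine Finset.sum_congr rfl fun c _ => ?_
    simp only [matOfKer, wv, T.wi_idx i' hk', T.wk_idx i' hk']
  · have hk'' : ¬ (-cd.Kb ≤ k' ∧ k' ≤ cd.Ka) := by rw [hKb, hKa]; exact hk'
    unfold kapp
    rw [if_neg hk'', T.linF_off _ v i' hk']

/-- **`KerMem` in the end kernels of an interval matrix ⇒ `MemMat` of the coordinate matrix.** [folklore] -/
theorem memMat_matOfKer {cd : CertData} (hKb : cd.Kb = T.Kb) (hKa : cd.Ka = T.Ka) {A : Ker} {M : Array (Array IntervalD)}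
    (hA : KerMem cd A (T.kerLo M) (T.kerHi M)) : MemMat T.n (T.matOfKer A) M := by
  intro r hr c hc
  have hkr := T.InW_wk hr
  have hkc := T.InW_wk hc
  have h := hA (T.wi r) (T.wk r) (by rw [hKb]; exact hkr.1) (by rw [hKa]; exact hkr.2) (T.wi c) (T.wk c)
    (by rw [hKb]; exact hkc.1) (by rw [hKa]; exact hkc.2)
  simp only [kerLo, kerHi, T.idx_wi_wk hr, T.idx_wi_wk hc] at h
  exact h

/-- Converse: a coordinate matrix in an interval matrix gives a kernel in the end kernels. [folklore] -/
theorem kerMem_kerOfMat {cd : CertData} (hKb : cd.Kb = T.Kb) (hKa : cd.Ka = T.Ka) {a : ℕ → ℕ → ℝ}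
    {M : Array (Array IntervalD)} (ha : MemMat T.n a M) : KerMem cd (T.kerOfMat a) (T.kerLo M) (T.kerHi M) := by
  intro i' k' hk1' hk2' i k hk1 hk2
  have hk' : -T.Kb ≤ k' ∧ k' ≤ T.Ka := by rw [← hKb, ← hKa]; exact ⟨hk1', hk2'⟩
  have hk : -T.Kb ≤ k ∧ k ≤ T.Ka := by rw [← hKb, ← hKa]; exact ⟨hk1, hk2⟩
  exact ha _ (T.idx_lt_n i' hk') _ (T.idx_lt_n i hk)

/-! ### Absolute bounds and boxes -/

/-- A window absolute bound by a `vecF`-vector, in coordinates. [folklore] -/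
theorem absLeVec_of_absLeW {cd : CertData} (hKb : cd.Kb = T.Kb) (hKa : cd.Ka = T.Ka) {v : Fin 4 → ℤ → ℝ} {R : Array Dyad}
    (h : AbsLeW cd v (T.vecF (vre R))) : AbsLeVec T.n (T.wv v) R := by
  intro c hc
  have hk := T.InW_wk hc
  have h1 := h (T.wi c) (T.wk c) (by rw [hKb]; exact hk.1) (by rw [hKa]; exact hk.2)
  rw [T.vecF_apply, if_pos hk, T.idx_wi_wk hc] at h1
  exact h1

/-- Conversely, a coordinate absolute bound gives the window bound by the `vecF`-vector. [folklore] -/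
theorem absLeW_vecF_of_absLeVec {cd : CertData} (hKb : cd.Kb = T.Kb) (hKa : cd.Ka = T.Ka) {v : Fin 4 → ℤ → ℝ}
    {R : Array Dyad} (h : AbsLeVec T.n (T.wv v) R) : AbsLeW cd v (T.vecF (vre R)) := by
  intro i k hk1 hk2
  have hk : -T.Kb ≤ k ∧ k ≤ T.Ka := by rw [← hKb, ← hKa]; exact ⟨hk1, hk2⟩
  have h1 := h (T.idx i k) (T.idx_lt_n i hk)
  rw [T.wv_idx v i hk] at h1
  rw [T.vecF_apply, if_pos hk]
  exact h1

/-- Membership in a `vecF`-box, in coordinates. [folklore] -/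
theorem inBox_vecF_iff {cd : CertData} (hKb : cd.Kb = T.Kb) (hKa : cd.Ka = T.Ka) (lo hi : ℕ → ℝ) (y : Fin 4 → ℤ → ℝ) :
    InBox cd (T.vecF lo) (T.vecF hi) y ↔ ∀ c < T.n, lo c ≤ T.wv y c ∧ T.wv y c ≤ hi c := by
  constructor
  · intro h c hc
    have hk := T.InW_wk hc
    have h1 := h (T.wi c) (T.wk c) (by rw [hKb]; exact hk.1) (by rw [hKa]; exact hk.2)
    rw [T.vecF_apply, T.vecF_apply, if_pos hk, if_pos hk, T.idx_wi_wk hc] at h1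
    exact h1
  · intro h i k hk1 hk2
    have hk : -T.Kb ≤ k ∧ k ≤ T.Ka := by rw [← hKb, ← hKa]; exact ⟨hk1, hk2⟩
    have h1 := h (T.idx i k) (T.idx_lt_n i hk)
    rw [T.wv_idx y i hk] at h1
    rw [T.vecF_apply, T.vecF_apply, if_pos hk, if_pos hk]
    exact h1

end CertTables

/-! ### The named inverse under the node test -/

section Inv

variable {n : ℕ} (prec : ℕ)

/-- Range sums as `Fin` sums. [folklore] -/
private theorem sum_range_eq_univ' (f : ℕ → ℝ) : ∑ t ∈ Finset.range n, f t = ∑ t : Fin n, f t :=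
  Finset.sum_range f

/-- **`invMat` under `nodeOK`**: the two-sided inverse of `dre N.B` on the block, inside `N.Ci`. [folklore] -/
theorem invMat_spec_of_nodeOK {N : NodeSt} (h : nodeOK n prec N = true) :
    (∀ r < n, ∀ c < n, ∑ t ∈ Finset.range n, dre N.B r t * invMat n N.B t c = if r = c then 1 else 0) ∧
    (∀ r < n, ∀ c < n, ∑ t ∈ Finset.range n, invMat n N.B r t * dre N.B t c = if r = c then 1 else 0) ∧
    MemMat n (invMat n N.B) N.Ci := by
  obtain ⟨⟨g, hg1, hg2, hg3⟩, -, -⟩ := exists_inv_of_nodeOK prec h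
  -- the `Fin n` matrices
  have hleft : toMat n g * toMat n (dre N.B) = 1 := by
    ext i j
    rw [Matrix.mul_apply, Matrix.one_apply]
    have e := hg2 i i.isLt j j.isLt
    rw [sum_range_eq_univ'] at e
    simp only [toMat, Matrix.of_apply, Fin.ext_iff] at e ⊢
    exact e
  have hinv : (toMat n (dre N.B))⁻¹ = toMat n g := Matrix.inv_eq_left_inv hleft
  -- `invMat` agrees with `g` on the block
  have hagree : ∀ r < n, ∀ c < n, invMat n N.B r c = g r c := fun r hr c hc => by
    simp only [invMat, dif_pos hr, dif_pos hc]
    rw [hinv]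
    rfl
  refine ⟨fun r hr c hc => ?_, fun r hr c hc => ?_, fun r hr c hc => ?_⟩
  · rw [← hg1 r hr c hc]
    exact Finset.sum_congr rfl fun t ht => by rw [hagree t (Finset.mem_range.1 ht) c hc]
  · rw [← hg2 r hr c hc]
    exact Finset.sum_congr rfl fun t ht => by rw [hagree r hr t (Finset.mem_range.1 ht)]
  · rw [hagree r hr c hc]; exact hg3 r hr c hc

/-- The interpreted frame and its inverse compose to the identity on window-supported states (`Ci ∘ Cm`). [folklore] -/
theorem linF_invMat_linF {K : Type} (T : CertTables K) {N : NodeSt} (h : nodeOK T.n prec N = true)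
    {y : Fin 4 → ℤ → ℝ} (hy : ∀ i k, ¬ (-T.Kb ≤ k ∧ k ≤ T.Ka) → y i k = 0) :
    T.linF (invMat T.n N.B) (T.linF (dre N.B) y) = y := by
  rw [T.linF_linF]
  exact T.linF_eq_self_of_id (invMat_spec_of_nodeOK prec h).2.1 hy

/-- … and `Cm ∘ Ci`. [folklore] -/
theorem linF_linF_invMat {K : Type} (T : CertTables K) {N : NodeSt} (h : nodeOK T.n prec N = true)
    {y : Fin 4 → ℤ → ℝ} (hy : ∀ i k, ¬ (-T.Kb ≤ k ∧ k ≤ T.Ka) → y i k = 0) :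
    T.linF (dre N.B) (T.linF (invMat T.n N.B) y) = y := by
  rw [T.linF_linF]
  exact T.linF_eq_self_of_id (invMat_spec_of_nodeOK prec h).1 hy

end Inv


/-! ### Range-sum matrix algebra (for the (R5) identity) -/

section MulF

variable (n : ℕ)

/-- The `n`-range matrix product of coordinate matrices. [folklore] -/
noncomputable def mulF (a b : ℕ → ℕ → ℝ) : ℕ → ℕ → ℝ := fun r c => ∑ t ∈ Finset.range n, a r t * b t c

/-- Associativity of the range product (unconditional: finite sums). [folklore] -/
theorem mulF_assoc (a b d : ℕ → ℕ → ℝ) : mulF n (mulF n a b) d = mulF n a (mulF n b d) := by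
  funext r c
  simp only [mulF, Finset.sum_mul, Finset.mul_sum]
  rw [Finset.sum_comm]
  exact Finset.sum_congr rfl fun u _ => Finset.sum_congr rfl fun t _ => by ring

/-- A block identity on the left acts as the identity on the block rows. [folklore] -/
theorem mulF_id_left {d : ℕ → ℕ → ℝ} (hd : ∀ r < n, ∀ c < n, d r c = if r = c then 1 else 0) (a : ℕ → ℕ → ℝ)
    {r : ℕ} (hr : r < n) (c : ℕ) : mulF n d a r c = a r c := by
  simp only [mulF]
  rw [Finset.sum_congr rfl fun t ht => by rw [hd r hr t (Finset.mem_range.1 ht)]]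
  simp [Finset.sum_ite_eq, hr]

/-- Left distributivity over entrywise sums. [folklore] -/
theorem mulF_add (a b d : ℕ → ℕ → ℝ) : mulF n a (fun r c => b r c + d r c) = fun r c => mulF n a b r c + mulF n a d r c := by
  funext r c; simp only [mulF, mul_add, Finset.sum_add_distrib]

/-- Left distributivity over entrywise differences. [folklore] -/
theorem mulF_sub (a b d : ℕ → ℕ → ℝ) : mulF n a (fun r c => b r c - d r c) = fun r c => mulF n a b r c - mulF n a d r c := by
  funext r c; simp only [mulF, mul_sub, Finset.sum_sub_distrib]

end MulF

namespace CertTables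

variable {K : Type} (T : CertTables K)

/-- `linF a ∘ linF b = linF (a·b)` (restated with `mulF`). [folklore] -/
theorem linF_linF_mulF (a b : ℕ → ℕ → ℝ) (y : Fin 4 → ℤ → ℝ) : T.linF a (T.linF b y) = T.linF (mulF T.n a b) y :=
  T.linF_linF a b y

/-- `linF` is additive in the matrix. [folklore] -/
theorem linF_matAdd (a b : ℕ → ℕ → ℝ) (y : Fin 4 → ℤ → ℝ) :
    T.linF (fun r c => a r c + b r c) y = T.linF a y + T.linF b y := by
  funext i k
  by_cases hk : -T.Kb ≤ k ∧ k ≤ T.Ka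
  · simp only [Pi.add_apply, T.linF_apply_of_InW _ y i hk, add_mul, Finset.sum_add_distrib]
  · simp only [Pi.add_apply, T.linF_off _ y i hk, add_zero]

/-- `linF` is subtractive in the matrix. [folklore] -/
theorem linF_matSub (a b : ℕ → ℕ → ℝ) (y : Fin 4 → ℤ → ℝ) :
    T.linF (fun r c => a r c - b r c) y = T.linF a y - T.linF b y := by
  funext i k
  by_cases hk : -T.Kb ≤ k ∧ k ≤ T.Ka
  · simp only [Pi.sub_apply, T.linF_apply_of_InW _ y i hk, sub_mul, Finset.sum_sub_distrib]
  · simp only [Pi.sub_apply, T.linF_off _ y i hk, sub_zero]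

/-- `linF a` is additive in the state. [folklore] -/
theorem linF_add (a : ℕ → ℕ → ℝ) (y y' : Fin 4 → ℤ → ℝ) : T.linF a (y + y') = T.linF a y + T.linF a y' :=
  (T.isLinearMap_linF a).map_add y y'

end CertTables

end Summit.NavierStokesRegularity.NavierStokesRegularity.Theorems.TaylorModelCert
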